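import Summits.Ventures.PercRepro.ProfilePointedUnifOddSum

/-!
# PercRepro — THE ODD CASE, THE ARITHMETIC: (Ĉ) AT `(N, p)` FROM (Ĉ) AT THE MINORS `M(T₀, ·)` OF A
`U_{s+1,2s+1}`-RESTRICTION — A MINIMAL (Ĉ)-WITNESS HAS NO `U_{s+1,2s+1}`-RESTRICTION, `s ≥ 1`: NO THREE POINTS OF
RANK TWO, EVERY THREE-SUBSET INDEPENDENT (p10, gen 24; modulo Theorem A = the named fact)

With `#E = m + 2s` (`m = #E(M(T₀, f))`, `card_gr_oddMinor`) and `k = j + s`, the splits of ProfilePointedUnifOddSum turn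
(Ĉ) at `(N, p, k)` into a SUM over the `s`-subsets `T₀` of `L` of inequalities on `m` elements, inside the window
`2j + 2 ≤ m` where Theorem A gives `P_j ≤ P_{j+1}` on every minor:
* `p ∉ L` (`pointedRowAt_odd_of_fact`): the `T₀`-term is (Ĉ) at `(M(T₀, f T₀), p, j)` plus `s` copies of `P_j ≤ P_{j+1}`;
* `p ∈ L` (`pointedRowAt_odd_of_mem_of_fact`): for `T₀ ∌ p` the term is (Ĉ) at `(M(T₀, p), p, j)` plus `s` copies of the
  monotonicity; for `T₀ ∋ p` there is no extension term and the inequality `(m + s − j − 1)·P_j ≤ (j + s)·P_{j+1}` is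
  Theorem A's `(m − j)·P_j ≤ (j + 1)·P_{j+1}` plus `s − 1` copies of the monotonicity — no (Ĉ)-hypothesis there.
Below level `s` nothing is bi-independent.  CONSEQUENCES: `not_pointedRowAt_odd_of_fact` (a failure at `(N, p)`, `p ∉ L`,
is a failure at some `(M(T₀, f T₀), p)` on `2s` fewer elements), `MinimalWitness.not_oddRestriction` (a minimal witness has
no `U_{s+1,2s+1}`-restriction for any `s ≥ 1`), `MinimalWitness.card_le_two_of_rk_two` (a set of rank `2` in a minimal
witness has at most `2` elements — with ProfilePointedUniformRestrictionLine's `≤ 3`: NO LINE WITH THREE OR MORE POINTS),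
`MinimalWitness.rk_eq_three_of_card_three` (EVERY THREE-SUBSET OF A MINIMAL WITNESS IS INDEPENDENT: every circuit has at
least four elements).  Nothing here asserts (Ĉ).
-/

open scoped Matroid

namespace PercRepro.Cogirth

open Finset ThmH Skew

variable {α : Type} [DecidableEq α] {N : Matroid α} [N.Finite]

section oddrow

variable {L : Finset α} {s : ℕ}

/-- The number of elements of `M(T₀, f)`: `#E − 2s`. -/
theorem card_gr_oddMinor (hL : OddRestriction N L s) {T₀ : Finset α} (hT₀ : T₀ ⊆ L) {f : α} (hfL : f ∈ L)
    (hfT : f ∉ T₀) : (gr (oddMinor N L T₀ f)).card = (gr N).card - 2 * s := by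
  rw [gr_oddMinor hT₀ hfT, card_sdiff_of_subset ((erase_subset f L).trans hL.subset_gr), card_erase_of_mem hfL,
    hL.card_eq]
  rfl

omit [DecidableEq α] in
/-- `#E ≥ 2s + 1`. -/
theorem card_gr_ge_odd (hL : OddRestriction N L s) : 2 * s + 1 ≤ (gr N).card := by
  have := card_le_card hL.subset_gr
  rw [hL.card_eq] at this
  exact this

/-- The termwise inequality at a minor carrying the point: (Ĉ) at `(M, p, j)` plus `s` copies of `P_j ≤ P_{j+1}` gives
`(m + s − j − 1)·P_j ≤ (j + s)·P_{j+1} + (m − 2j − 1)·c_j` (CONDITIONAL on the named fact). -/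
theorem odd_term_le_of_fact (hfact : BiIndepDensityLogConcave α) (M : Matroid α) [M.Finite] {p : α} {j : ℕ}
    (hj : 2 * j + 2 ≤ (gr M).card) (h : PointedRowAt M p) (s : ℕ) :
    ((gr M).card + s - j - 1) * (biIndepSets M j).card ≤
      (j + s) * (biIndepSets M (j + 1)).card + ((gr M).card - 2 * j - 1) * extCount M j p := by
  have hC := h j hj
  have hmono := card_biIndepSets_le_succ_of_fact hfact M j hj
  obtain ⟨m, hm⟩ : ∃ m, (gr M).card = m + 2 * j + 2 := ⟨(gr M).card - 2 * j - 2, by omega⟩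
  rw [hm] at hC ⊢
  rw [show m + 2 * j + 2 + s - j - 1 = m + j + 1 + s by omega,
    show m + 2 * j + 2 - 2 * j - 1 = m + 1 by omega]
  rw [show m + 2 * j + 2 - j - 1 = m + j + 1 by omega, show m + 2 * j + 2 - 2 * j - 1 = m + 1 by omega] at hC
  generalize (biIndepSets M j).card = P0 at hC hmono ⊢
  generalize (biIndepSets M (j + 1)).card = P1 at hC hmono ⊢
  generalize extCount M j p = c0 at hC ⊢
  calc (m + j + 1 + s) * P0 = (m + j + 1) * P0 + s * P0 := by ring
    _ ≤ (j * P1 + (m + 1) * c0) + s * P1 := Nat.add_le_add hC (Nat.mul_le_mul_left _ hmono)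
    _ = (j + s) * P1 + (m + 1) * c0 := by ring

/-- The termwise inequality at a minor NOT carrying the point: Theorem A's `(m − j)·P_j ≤ (j + 1)·P_{j+1}` plus `s − 1`
copies of `P_j ≤ P_{j+1}` give `(m + s − j − 1)·P_j ≤ (j + s)·P_{j+1}` (CONDITIONAL on the named fact; `s ≥ 1`). -/
theorem odd_term_le_of_fact' (hfact : BiIndepDensityLogConcave α) (M : Matroid α) [M.Finite] {j : ℕ}
    (hj : 2 * j + 2 ≤ (gr M).card) {s : ℕ} (hs : 1 ≤ s) :
    ((gr M).card + s - j - 1) * (biIndepSets M j).card ≤ (j + s) * (biIndepSets M (j + 1)).card := by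
  have hA := biIndepDensity_mono_of_fact hfact M j hj
  have hmono := card_biIndepSets_le_succ_of_fact hfact M j hj
  obtain ⟨m, hm⟩ : ∃ m, (gr M).card = m + 2 * j + 2 := ⟨(gr M).card - 2 * j - 2, by omega⟩
  rw [hm] at hA ⊢
  rw [show m + 2 * j + 2 + s - j - 1 = m + j + 2 + (s - 1) by omega]
  rw [show m + 2 * j + 2 - j = m + j + 2 by omega] at hA
  generalize (biIndepSets M j).card = P0 at hA hmono ⊢
  generalize (biIndepSets M (j + 1)).card = P1 at hA hmono ⊢
  calc (m + j + 2 + (s - 1)) * P0 = (m + j + 2) * P0 + (s - 1) * P0 := by ring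
    _ ≤ (j + 1) * P1 + (s - 1) * P1 := Nat.add_le_add hA (Nat.mul_le_mul_left _ hmono)
    _ = (j + s) * P1 := by rw [← add_mul]; congr 1; omega

/-- **(Ĉ) AT `(N, p)` FROM (Ĉ) AT THE MINORS, `p ∉ L`** (CONDITIONAL on the named fact): for a
`U_{s+1,2s+1}`-restriction `L ∌ p` and any choice `f T₀ ∈ L ∖ T₀`, (Ĉ) at every level of every `(M(T₀, f T₀), p)`
gives (Ĉ) at every level of `(N, p)`. -/
theorem pointedRowAt_odd_of_fact (hfact : BiIndepDensityLogConcave α) (hL : OddRestriction N L s)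
    (f : Finset α → α) (hf : ∀ T₀ ∈ L.powersetCard s, f T₀ ∈ L ∧ f T₀ ∉ T₀) {p : α} (hp : p ∈ gr N) (hpL : p ∉ L)
    (h : ∀ T₀ ∈ L.powersetCard s, PointedRowAt (oddMinor N L T₀ (f T₀)) p) : PointedRowAt N p := by
  intro k hk
  rcases Nat.lt_or_ge k s with hks | hks
  · rw [card_biIndepSets_odd_eq_zero_of_lt hL hks, mul_zero]
    exact Nat.zero_le _
  · obtain ⟨j, rfl⟩ : ∃ j, k = j + s := ⟨k - s, by omega⟩
    rw [card_biIndepSets_odd hL f hf hks, card_biIndepSets_odd hL f hf (by omega : s ≤ j + s + 1),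
      extCount_odd hL f hf hp hpL hks, show j + s - s = j by omega, show j + s + 1 - s = j + 1 by omega,
      mul_sum, mul_sum, mul_sum, ← sum_add_distrib]
    apply sum_le_sum
    intro T₀ hT₀
    obtain ⟨hfL, hfT⟩ := hf T₀ hT₀
    have hm := card_gr_oddMinor hL (mem_powersetCard.1 hT₀).1 hfL hfT
    have hge := card_gr_ge_odd hL
    have hj : 2 * j + 2 ≤ (gr (oddMinor N L T₀ (f T₀))).card := by rw [hm]; omega
    have := odd_term_le_of_fact hfact (oddMinor N L T₀ (f T₀)) hj (h T₀ hT₀) s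
    rw [hm, show (gr N).card - 2 * s + s - j - 1 = (gr N).card - (j + s) - 1 by omega,
      show (gr N).card - 2 * s - 2 * j - 1 = (gr N).card - 2 * (j + s) - 1 by omega] at this
    exact this

/-- A choice of a point of `L ∖ T₀` for every `T₀` (equal to `p` whenever `p ∉ T₀`). -/
noncomputable def oddChoice (L : Finset α) (p : α) (T₀ : Finset α) : α :=
  if p ∈ T₀ then (if h : (L \ T₀).Nonempty then h.choose else p) else p

/-- `oddChoice L p T₀` is a point of `L ∖ T₀` (for `p ∈ L`). -/
theorem oddChoice_spec (hL : OddRestriction N L s) (p : α) {T₀ : Finset α} (hT₀ : T₀ ∈ L.powersetCard s)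
    (hpL : p ∈ L) : oddChoice L p T₀ ∈ L ∧ oddChoice L p T₀ ∉ T₀ := by
  obtain ⟨hT₀L, hT₀c⟩ := mem_powersetCard.1 hT₀
  unfold oddChoice
  by_cases hpT : p ∈ T₀
  · rw [if_pos hpT]
    have hne : (L \ T₀).Nonempty := by
      rw [← card_pos, card_sdiff_of_subset hT₀L, hL.card_eq, hT₀c]
      omega
    rw [dif_pos hne]
    have := hne.choose_spec
    exact ⟨(mem_sdiff.1 this).1, (mem_sdiff.1 this).2⟩
  · rw [if_neg hpT]
    exact ⟨hpL, hpT⟩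

/-- `oddChoice L p T₀ = p` whenever `p ∉ T₀`. -/
theorem oddChoice_of_notMem (L : Finset α) (p : α) {T₀ : Finset α} (hpT : p ∉ T₀) : oddChoice L p T₀ = p := by
  unfold oddChoice
  rw [if_neg hpT]

/-- **(Ĉ) AT A POINT OF A `U_{s+1,2s+1}`-RESTRICTION FROM (Ĉ) AT THE MINORS THROUGH IT** (CONDITIONAL on the named
fact): for `p ∈ L`, `s ≥ 1`, (Ĉ) at every level of `(M(T₀, p), p)` for the `s`-subsets `T₀ ⊆ L` avoiding `p` gives (Ĉ) at
every level of `(N, p)` — the minors through the other `T₀` contribute Theorem A alone. -/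
theorem pointedRowAt_odd_of_mem_of_fact (hfact : BiIndepDensityLogConcave α) (hL : OddRestriction N L s)
    (hs : 1 ≤ s) {p : α} (hpL : p ∈ L)
    (h : ∀ T₀ ∈ L.powersetCard s, p ∉ T₀ → PointedRowAt (oddMinor N L T₀ p) p) : PointedRowAt N p := by
  intro k hk
  rcases Nat.lt_or_ge k s with hks | hks
  · rw [card_biIndepSets_odd_eq_zero_of_lt hL hks, mul_zero]
    exact Nat.zero_le _
  · obtain ⟨j, rfl⟩ : ∃ j, k = j + s := ⟨k - s, by omega⟩
    have hf : ∀ T₀ ∈ L.powersetCard s, oddChoice L p T₀ ∈ L ∧ oddChoice L p T₀ ∉ T₀ :=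
      fun T₀ hT₀ => oddChoice_spec hL p hT₀ hpL
    rw [card_biIndepSets_odd hL (oddChoice L p) hf hks,
      card_biIndepSets_odd hL (oddChoice L p) hf (by omega : s ≤ j + s + 1), extCount_odd_mem hL hpL hks,
      show j + s - s = j by omega, show j + s + 1 - s = j + 1 by omega, mul_sum, mul_sum, mul_sum,
      ← sum_filter_add_sum_filter_not (L.powersetCard s) (fun T₀ => p ∉ T₀),
      ← sum_filter_add_sum_filter_not (L.powersetCard s) (fun T₀ => p ∉ T₀) (fun T₀ => (j + s) * _)]
    have hge := card_gr_ge_odd hL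
    have h1 : ∑ T₀ ∈ (L.powersetCard s).filter (fun T₀ => p ∉ T₀),
        ((gr N).card - (j + s) - 1) * (biIndepSets (oddMinor N L T₀ (oddChoice L p T₀)) j).card ≤
        ∑ T₀ ∈ (L.powersetCard s).filter (fun T₀ => p ∉ T₀),
          (j + s) * (biIndepSets (oddMinor N L T₀ (oddChoice L p T₀)) (j + 1)).card +
        ∑ T₀ ∈ (L.powersetCard s).filter (fun T₀ => p ∉ T₀),
          ((gr N).card - 2 * (j + s) - 1) * extCount (oddMinor N L T₀ p) j p := by
      rw [← sum_add_distrib]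
      apply sum_le_sum
      intro T₀ hT₀
      rw [mem_filter] at hT₀
      obtain ⟨hT₀, hpT⟩ := hT₀
      rw [oddChoice_of_notMem L p hpT]
      have hm := card_gr_oddMinor hL (mem_powersetCard.1 hT₀).1 hpL hpT
      have hj : 2 * j + 2 ≤ (gr (oddMinor N L T₀ p)).card := by rw [hm]; omega
      have := odd_term_le_of_fact hfact (oddMinor N L T₀ p) hj (h T₀ hT₀ hpT) s
      rw [hm, show (gr N).card - 2 * s + s - j - 1 = (gr N).card - (j + s) - 1 by omega,
        show (gr N).card - 2 * s - 2 * j - 1 = (gr N).card - 2 * (j + s) - 1 by omega] at this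
      exact this
    have h2 : ∑ T₀ ∈ (L.powersetCard s).filter (fun T₀ => ¬ p ∉ T₀),
        ((gr N).card - (j + s) - 1) * (biIndepSets (oddMinor N L T₀ (oddChoice L p T₀)) j).card ≤
        ∑ T₀ ∈ (L.powersetCard s).filter (fun T₀ => ¬ p ∉ T₀),
          (j + s) * (biIndepSets (oddMinor N L T₀ (oddChoice L p T₀)) (j + 1)).card := by
      apply sum_le_sum
      intro T₀ hT₀
      rw [mem_filter] at hT₀
      obtain ⟨hT₀, -⟩ := hT₀
      obtain ⟨hfL, hfT⟩ := hf T₀ hT₀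
      have hm := card_gr_oddMinor hL (mem_powersetCard.1 hT₀).1 hfL hfT
      have hj : 2 * j + 2 ≤ (gr (oddMinor N L T₀ (oddChoice L p T₀))).card := by rw [hm]; omega
      have := odd_term_le_of_fact' hfact (oddMinor N L T₀ (oddChoice L p T₀)) hj hs
      rw [hm, show (gr N).card - 2 * s + s - j - 1 = (gr N).card - (j + s) - 1 by omega] at this
      exact this
    omega

/-- **A (Ĉ)-failure at `(N, p)` with a `U_{s+1,2s+1}`-restriction avoiding `p` is a failure at some `(M(T₀, f T₀), p)`**,
on `2s` fewer elements (CONDITIONAL on the named fact). -/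
theorem not_pointedRowAt_odd_of_fact (hfact : BiIndepDensityLogConcave α) (hL : OddRestriction N L s)
    (f : Finset α → α) (hf : ∀ T₀ ∈ L.powersetCard s, f T₀ ∈ L ∧ f T₀ ∉ T₀) {p : α} (hp : p ∈ gr N) (hpL : p ∉ L)
    (h : ¬ PointedRowAt N p) : ∃ T₀ ∈ L.powersetCard s, ¬ PointedRowAt (oddMinor N L T₀ (f T₀)) p := by
  by_contra hall
  exact h (pointedRowAt_odd_of_fact hfact hL f hf hp hpL
    (fun T₀ hT₀ => by_contra (fun hc => hall ⟨T₀, hT₀, hc⟩)))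

/-- **A MINIMAL (Ĉ)-WITNESS HAS NO `U_{s+1,2s+1}`-RESTRICTION, FOR ANY `s ≥ 1`** (CONDITIONAL on the named fact): at
a point of `L` or away from it, the witness would shrink to a minor `M(T₀, ·)` on `2s` fewer elements. -/
theorem MinimalWitness.not_oddRestriction (hfact : BiIndepDensityLogConcave α) {p : α} (h : MinimalWitness N p)
    (hs : 1 ≤ s) (hL : OddRestriction N L s) : False := by
  obtain ⟨hp, hN, hmin⟩ := h
  have hge := card_gr_ge_odd hL
  by_cases hpL : p ∈ L
  · apply hN
    apply pointedRowAt_odd_of_mem_of_fact hfact hL hs hpL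
    intro T₀ hT₀ hpT
    obtain ⟨hT₀L, -⟩ := mem_powersetCard.1 hT₀
    apply hmin
    · rw [card_gr_oddMinor hL hT₀L hpL hpT]
      omega
    · rw [gr_oddMinor hT₀L hpT]
      exact mem_sdiff.2 ⟨hp, fun h' => (mem_erase.1 h').1 rfl⟩
  · -- any choice of `f`: take `oddChoice L p` with a dummy `p` (here `p ∉ L`, so use a point of `L` as the dummy)
    have hLne : L.Nonempty := by rw [← card_pos, hL.card_eq]; omega
    obtain ⟨q, hqL⟩ := hLne
    have hf : ∀ T₀ ∈ L.powersetCard s, oddChoice L q T₀ ∈ L ∧ oddChoice L q T₀ ∉ T₀ :=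
      fun T₀ hT₀ => oddChoice_spec hL q hT₀ hqL
    apply hN
    apply pointedRowAt_odd_of_fact hfact hL (oddChoice L q) hf hp hpL
    intro T₀ hT₀
    obtain ⟨hfL, hfT⟩ := hf T₀ hT₀
    obtain ⟨hT₀L, -⟩ := mem_powersetCard.1 hT₀
    apply hmin
    · rw [card_gr_oddMinor hL hT₀L hfL hfT]
      omega
    · rw [gr_oddMinor hT₀L hfT]
      exact mem_sdiff.2 ⟨hp, fun h' => hpL (mem_erase.1 h').2⟩

/-- **A SET OF RANK `2` IN A MINIMAL (Ĉ)-WITNESS HAS AT MOST TWO ELEMENTS** (CONDITIONAL on the named fact): three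
points of rank `2` would be a `U_{2,3}`-restriction. -/
theorem MinimalWitness.card_le_two_of_rk_two (hfact : BiIndepDensityLogConcave α) {p : α}
    (h : MinimalWitness N p) (hLg : L ⊆ gr N) (hLr : rk N L = 2) : L.card ≤ 2 := by
  by_contra hlt
  obtain ⟨L', hL'L, hL'c⟩ := exists_subset_card_eq (show 3 ≤ L.card by omega)
  have hL'g : L' ⊆ gr N := hL'L.trans hLg
  have hpairs : ∀ T ∈ L'.powersetCard 2, rk N T = 2 := by
    intro T hT
    obtain ⟨hTL, hTc⟩ := mem_powersetCard.1 hT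
    obtain ⟨x, y, hxy, rfl⟩ := card_eq_two.1 hTc
    exact h.rk_pair hfact (hL'g (hTL (mem_insert_self x {y}))) (hL'g (hTL (mem_insert_of_mem (mem_singleton_self y))))
      hxy
  have hL'r : rk N L' = 2 := by
    apply le_antisymm (hLr ▸ rk_mono' hL'L)
    obtain ⟨T, hTL, hTc⟩ := exists_subset_card_eq (show 2 ≤ L'.card by omega)
    rw [← hpairs T (mem_powersetCard.2 ⟨hTL, hTc⟩)]
    exact rk_mono' hTL
  exact h.not_oddRestriction hfact (le_refl 1) ⟨hL'g, by rw [hL'c], hL'r, hpairs⟩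

/-- **EVERY THREE-SUBSET OF A MINIMAL (Ĉ)-WITNESS IS INDEPENDENT** (CONDITIONAL on the named fact): the witness has
no circuit with fewer than four elements. -/
theorem MinimalWitness.rk_eq_three_of_card_three (hfact : BiIndepDensityLogConcave α) {p : α}
    (h : MinimalWitness N p) {T : Finset α} (hTg : T ⊆ gr N) (hTc : T.card = 3) : rk N T = 3 := by
  have h1 : rk N T ≤ 3 := hTc ▸ rk_le_card T
  obtain ⟨S, hST, hSc⟩ := exists_subset_card_eq (show 2 ≤ T.card by omega)
  obtain ⟨x, y, hxy, rfl⟩ := card_eq_two.1 hSc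
  have h2 : rk N {x, y} = 2 :=
    h.rk_pair hfact (hTg (hST (mem_insert_self x {y}))) (hTg (hST (mem_insert_of_mem (mem_singleton_self y)))) hxy
  have h3 : 2 ≤ rk N T := h2 ▸ rk_mono' hST
  by_contra hne
  have hT2 : rk N T = 2 := by omega
  have := h.card_le_two_of_rk_two hfact hTg hT2
  omega

end oddrow

end PercRepro.Cogirth
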